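import Summits.Ventures.PercRepro.BlockSumBaseLayer

/-!
# PercRepro — C-025 on `T_p(B ⊕ U_{m,m})` from the base layers at the levels `q ≥ 3` alone (p9, gen 14)

`BlockSumBaseLayer` needed the base-layer inequality at EVERY level, including `q = 0, 1, 2`, whose binomials
`c_{q−c+i}` vanish and which the symbolic certificates of `proofs/P9-S4-KBLOCKS-g14.md` do not cover. The tree proves
C-025 at the levels `q ≤ 2` on EVERY finite matroid (`c025_of_q_zero`, `c025_of_q_one`, `ThmN.c025_two_all`), so the
strong induction of `profiles_ineq_of_baseLayer` can be run at the MATROID level with the lower levels supplied by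
those theorems on `T_{p−j}(B ⊕ U_{m₀,m₀})` (a subset of `F` of the right size): **`rls_blockFree_of_baseLayer_three`**
— for any finite block with `c ≤ ρX + ρ(E ∖ X)`, the base-layer inequalities at the levels `q ≥ 3` alone give C-025 on
`T_p(B ⊕ U_{m,m})` at every `(p, q)`, every `m ≥ p + q − c`. Nothing here is about any window of S4.
-/

namespace PercRepro.LineLadder

open Set Finset

variable {α : Type}

/-- A subset of a finite set of prescribed size. -/
lemma exists_subset_ncard_eq_of_le {F : Set α} (hF : F.Finite) {n : ℕ} (hn : n ≤ F.ncard) :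
    ∃ F' ⊆ F, F'.ncard = n := by
  obtain ⟨F', hF'F, hcard⟩ := Set.exists_subset_encard_eq (k := (n : ℕ∞))
    (by rw [← hF.cast_ncard_eq]; exact_mod_cast hn)
  refine ⟨F', hF'F, ?_⟩
  have := (hF.subset hF'F).cast_ncard_eq
  rw [hcard] at this
  exact_mod_cast this

/-- **C-025 ON `T_p(B ⊕ U_{m,m})` FROM THE BASE LAYERS AT THE LEVELS `q ≥ 3`**: for a finite block `B` with
`c ≤ ρ_B X + ρ_B(B.E ∖ X)` for every `X ⊆ B.E`, if the profile inequality holds at the base layer `m = p + q − c` for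
every `(p, q)` with `3 ≤ q` and `q + 2 ≤ p`, then `RLS` holds for `T_p(B ⊕ U_{m,m})` at every `(p, q)` with
`q + 2 ≤ p` and every `m ≥ p + q − c` (the levels `q ≤ 2` by the tree's theorems for every matroid). -/
theorem rls_blockFree_of_baseLayer_three (B : Matroid α) [B.Finite] (c : ℕ)
    (hact : ∀ X ⊆ B.E, c ≤ (B.eRk X).toNat + (B.eRk (B.E \ X)).toNat)
    (hbase : ∀ p q : ℕ, 3 ≤ q → q + 2 ≤ p →
      phiK p q * ((∑ X ∈ B.ground_finite.finite_subsets.toFinset, ∑ a ∈ range (p + q - c + 1),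
          (if min p ((B.eRk X).toNat + a) = p ∧ min p ((B.eRk (B.E \ X)).toNat + (p + q - c - a)) = q
            then (p + q - c).choose a else 0) : ℕ) : ℚ)
        ≤ ((∑ X ∈ B.ground_finite.finite_subsets.toFinset, ∑ a ∈ range (p + q - c + 1),
          (if q < min p ((B.eRk X).toNat + a) ∧ min p ((B.eRk X).toNat + a) < p
            then (p + q - c).choose a else 0) : ℕ) : ℚ)) :
    ∀ (q : ℕ) {F : Set α} (hF : F.Finite) (hBF : Disjoint B.E (Matroid.freeOn F).E) (p : ℕ),
      q + 2 ≤ p → p + q - c ≤ F.ncard →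
      @ThmN.RLS α (@PercRepro.Matroid.truncate α (B.disjointSum (Matroid.freeOn F) hBF) (blockFree_finite B hF hBF) p)
        (@PercRepro.Matroid.truncate_finite α _ (blockFree_finite B hF hBF) p) p q := by
  intro q
  induction q using Nat.strong_induction_on with
  | _ q ih =>
    intro F hF hBF p hpq hm
    rcases Nat.lt_or_ge q 3 with hq | hq
    · interval_cases q
      · exact c025_of_q_zero p
      · exact c025_of_q_one _ p
      · exact ThmN.c025_two_all _ p (by omega)
    · unfold ThmN.RLS
      rw [ncard_U_blockFree' B hF hBF p q, ncard_Y_blockFree' B hF hBF p q]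
      refine profiles_ineq_of_base B.ground_finite.finite_subsets.toFinset (fun X => (B.eRk X).toNat)
        (fun X => (B.eRk (B.E \ X)).toNat) q p (p + q - c) hpq
        (fun X hX => by
          have := hact X (by rwa [Set.Finite.mem_toFinset, mem_setOf_eq] at hX)
          omega) ?_ F.ncard hm
      intro j hj
      rcases Nat.eq_zero_or_pos j with hj0 | hj0
      · subst hj0
        simpa using hbase p q hq hpq
      · obtain ⟨F', hF'F, hF'card⟩ := exists_subset_ncard_eq_of_le hF hm
        have hF' : F'.Finite := hF.subset hF'F
        have hBF' : Disjoint B.E (Matroid.freeOn F').E := by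
          rw [Matroid.freeOn_ground] at hBF ⊢
          exact hBF.mono_right hF'F
        have key := ih (q - j) (by omega) hF' hBF' (p - j) (by omega) (by omega)
        unfold ThmN.RLS at key
        rw [ncard_U_blockFree' B hF' hBF' (p - j) (q - j), ncard_Y_blockFree' B hF' hBF' (p - j) (q - j),
          hF'card] at key
        exact key

end PercRepro.LineLadder
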